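import Literature.AlgebraicGeometry.Modules.PushforwardBaseChangeHom
import HarnessLib

/-!
# Base change of `p_*` along an OPEN IMMERSION of the base is an isomorphism: `(p_* G)|_T ⥲ (p_T)_* (G|_{X_T})`

[StacksProject, Tag 02KG]/[Hartshorne1977] III Prop. 9.3 (the trivial case): for a cartesian square
```
X_T —pr→ X
 |pT      |p
 T  ——b——→ S
```
whose base morphism `b` is an OPEN IMMERSION (so `pr` is one too), the base-change morphism of ★
`Modules/PushforwardBaseChangeHom`, `β : b^*(p_* G) ⟶ pT_*(pr^* G)`, is an ISOMORPHISM for every `𝒪_X`-module `G`: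
both sides have sections `Γ(G, p⁻¹(b(W))) = Γ(G, pr(pT⁻¹ W))` over an open `W ⊆ T`
(Mathlib `IsOpenImmersion.image_preimage_eq_preimage_image_of_isPullback`), Mathlib's `restrictFunctorIsoPullback` identifies
`b^*`, `pr^*` with the restriction functors (whose sections ARE those, `restrictAppIso = Iso.refl`), and under these
identifications `β_W` is the identity — checked on elements through the pulled-back sections `η`
(★ `PullbackAffineChart.restrictFunctorIsoPullback_hom_app_map`, ★ `pushforwardBaseChangeHom_app_unitSection`).

Heads: `restrictFunctorIsoPullback_hom_app_eq` (the value of Mathlib's `restrictFunctorIsoPullback` on ANY section, as an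
`eqToHom`-transport of a pulled-back section), **`pushforwardBaseChangeHom_app_bijective_of_isOpenImmersion`**,
**`isIso_pushforwardBaseChangeHom_of_isOpenImmersion`** — the Zariski-localisation of the (hbc) hypothesis of ★
`Morphisms/ContainmentRepOfPushforward` (restricting `S` to an open never changes `p_*`).  Theorems only; no `sorry`, no
instance, no named fact.  Cell hodgecm-mathlib, F-DAG (h6-d)/(h2) input (L1) (B-plan1 (g15) 05:45Z brick, B-p03 pen 05:48Z:
consumed by F-8 (8b) charts and by the flat base change file).  HC_CM is proved only modulo the printed citations until rung
0 closes; this file discharges none of them.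

## References
* [StacksProject] The Stacks Project, Tag 02KG (Cohomology of Schemes, Lemma 30.5.1 and its trivial case), Tag 02N6 (base change map).
* [Hartshorne1977] R. Hartshorne, *Algebraic Geometry* (1977), III Prop. 9.3 (Remark 9.3.1), II §5 p. 110.
-/

noncomputable section

-- `TopCat.Presheaf`/`Scheme.Modules` are not reducible (as in Mathlib's `AlgebraicGeometry/Modules/Sheaf.lean`).
set_option backward.isDefEq.respectTransparency false

open CategoryTheory CategoryTheory.Limits AlgebraicGeometry TopologicalSpace Opposite

universe u

namespace Literature.AlgebraicGeometry.Modules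

/-! ### §1 Mathlib's `restrictFunctorIsoPullback` on arbitrary sections -/

section Restrict

variable {X Y : Scheme.{u}} (g : X ⟶ Y) [IsOpenImmersion g] (N : Y.Modules)

/-- **Mathlib's `restrictFunctorIsoPullback g : restrictFunctor g ≅ pullback g` on a section over ANY open `U ⊆ X`**: a section
of `N.restrict g` over `U` is a section `y ∈ Γ(N, g(U))`, and the isomorphism sends it to the pulled-back section `η_g(y)`
(a section over `g⁻¹(g(U)) = U`), transported along that equality of opens (★ `restrictFunctorIsoPullback_hom_app_map` is the case
of an open of the form `g⁻¹ W`). [cite: Hartshorne1977, II §5 p. 110] [cite: StacksProject, Tag 02N6] -/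
theorem restrictFunctorIsoPullback_hom_app_eq (U : X.Opens) (y : Γ(N.restrict g, U)) :
    ((Scheme.Modules.restrictFunctorIsoPullback g).hom.app N).app U y =
      ((Scheme.Modules.pullback g).obj N).presheaf.map (eqToHom (g.preimage_image_eq U).symm).op
        (unitSection g N (g ''ᵁ U) (show Γ(N, g ''ᵁ U) from y)) := by
  -- `U = g⁻¹(g U)`; move to the open `g⁻¹(g U)` where ★ `restrictFunctorIsoPullback_hom_app_map` applies
  have hU : U = g ⁻¹ᵁ g ''ᵁ U := (g.preimage_image_eq U).symm
  -- `y` is the restriction along `U = g⁻¹(g U)` of the section `y'` over `g⁻¹(g U)`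
  set y' : Γ(N.restrict g, g ⁻¹ᵁ g ''ᵁ U) := (N.restrict g).presheaf.map (eqToHom hU.symm).op y with hy'
  have hy : (N.restrict g).presheaf.map (eqToHom hU).op y' = y := by
    rw [hy', ← CategoryTheory.comp_apply, ← Functor.map_comp, ← op_comp, eqToHom_trans, eqToHom_refl, op_id,
      CategoryTheory.Functor.map_id]
    rfl
  have step : ((Scheme.Modules.restrictFunctorIsoPullback g).hom.app N).app U y =
      ((Scheme.Modules.pullback g).obj N).presheaf.map (eqToHom hU).op
        (((Scheme.Modules.restrictFunctorIsoPullback g).hom.app N).app (g ⁻¹ᵁ g ''ᵁ U) y') := by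
    rw [← app_presheaf_map, hy]
  -- `y'` as a section of `N` over `g(g⁻¹(g U))` is the restriction of `y ∈ Γ(N, g U)` along `g(g⁻¹(g U)) ≤ g U`
  have hy'' : y' = N.presheaf.map (homOfLE (g.image_preimage_le (g ''ᵁ U))).op (show Γ(N, g ''ᵁ U) from y) := by
    rw [hy', Scheme.Modules.restrict_map]
    exact presheaf_map_congr N _ _ _
  rw [step, hy'', restrictFunctorIsoPullback_hom_app_map]

end Restrict

/-! ### §2 The base-change morphism along an open immersion -/

section OpenImmersion

variable {X S T XT : Scheme.{u}} {pr : XT ⟶ X} {pT : XT ⟶ T} {p : X ⟶ S} {b : T ⟶ S}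
  (H : IsPullback pr pT p b) [IsOpenImmersion b] (G : X.Modules)

include H in
/-- In a cartesian square over an open immersion `b`, the top map `pr` is an open immersion (Mathlib: open immersions
are stable under base change). [cite: StacksProject, Tag 02KG] -/
theorem isOpenImmersion_fst_of_isPullback : IsOpenImmersion pr :=
  MorphismProperty.of_isPullback H.flip inferInstance

include H in
/-- The two opens of `X` over an open `W ⊆ T` agree: `p⁻¹(b(W)) = pr(pT⁻¹(W))` (Mathlib
`IsOpenImmersion.image_preimage_eq_preimage_image_of_isPullback`). [cite: StacksProject, Tag 02KG] -/
theorem preimage_image_eq_image_preimage (W : T.Opens) :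
    haveI := isOpenImmersion_fst_of_isPullback H
    p ⁻¹ᵁ b ''ᵁ W = pr ''ᵁ pT ⁻¹ᵁ W :=
  haveI := isOpenImmersion_fst_of_isPullback H
  (IsOpenImmersion.image_preimage_eq_preimage_image_of_isPullback H.flip W).symm

/-- **The base-change square on sections over `W ⊆ T`, along an open immersion `b`**: for `y ∈ Γ(G, p⁻¹(b W)) = Γ((p_*G).restrict b, W)`,
`β_W(θ_b(y)) = θ_{pr}(y|)` where `θ` are Mathlib's `restrictFunctorIsoPullback` components and `y|` is `y` read over
`pr(pT⁻¹ W) = p⁻¹(b W)` — both sides are the pulled-back section `η_{pr}(y)` restricted to `pT⁻¹ W`.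
[cite: StacksProject, Tag 02KG] [cite: Hartshorne1977, III Prop. 9.3 (Remark 9.3.1)] -/
theorem pushforwardBaseChangeHom_app_restrictFunctorIsoPullback (W : T.Opens)
    (y : Γ(((Scheme.Modules.pushforward p).obj G).restrict b, W)) :
    haveI := isOpenImmersion_fst_of_isPullback H
    (pushforwardBaseChangeHom H.w G).app W
        (((Scheme.Modules.restrictFunctorIsoPullback b).hom.app ((Scheme.Modules.pushforward p).obj G)).app W y) =
      ((Scheme.Modules.restrictFunctorIsoPullback pr).hom.app G).app (pT ⁻¹ᵁ W)
        (show Γ(G.restrict pr, pT ⁻¹ᵁ W) from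
          G.presheaf.map (eqToHom (preimage_image_eq_image_preimage H W).symm).op (show Γ(G, p ⁻¹ᵁ b ''ᵁ W) from y)) := by
  haveI := isOpenImmersion_fst_of_isPullback H
  rw [restrictFunctorIsoPullback_hom_app_eq, app_presheaf_map, restrictFunctorIsoPullback_hom_app_eq]
  erw [pushforwardBaseChangeHom_app_unitSection H.w G (b ''ᵁ W) (show Γ(G, p ⁻¹ᵁ b ''ᵁ W) from y)]
  -- both sides: restrictions of `η_pr` of (restrictions of) `y`; compare through `unitSection_map`
  have key : unitSection pr G (pr ''ᵁ pT ⁻¹ᵁ W)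
      (G.presheaf.map (eqToHom (preimage_image_eq_image_preimage H W).symm).op (show Γ(G, p ⁻¹ᵁ b ''ᵁ W) from y)) =
      ((Scheme.Modules.pullback pr).obj G).presheaf.map
        ((Opens.map pr.base).map (eqToHom (preimage_image_eq_image_preimage H W).symm)).op
        (unitSection pr G (p ⁻¹ᵁ b ''ᵁ W) (show Γ(G, p ⁻¹ᵁ b ''ᵁ W) from y)) :=
    unitSection_map pr G _ _
  rw [key]
  change (((Scheme.Modules.pullback pr).obj G).presheaf.map _ ≫ ((Scheme.Modules.pullback pr).obj G).presheaf.map _) _ =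
    (((Scheme.Modules.pullback pr).obj G).presheaf.map _ ≫ ((Scheme.Modules.pullback pr).obj G).presheaf.map _) _
  rw [← Functor.map_comp, ← Functor.map_comp]
  exact presheaf_map_congr _ _ _ _

/-- **`β_W` is bijective for every open `W ⊆ T` when `b` is an open immersion** (`β_W = θ_{pr} ∘ (transport) ∘ θ_b⁻¹` with all
three bijective). [cite: StacksProject, Tag 02KG] [cite: Hartshorne1977, III Prop. 9.3 (Remark 9.3.1)] -/
theorem pushforwardBaseChangeHom_app_bijective_of_isOpenImmersion (W : T.Opens) :
    Function.Bijective ((pushforwardBaseChangeHom H.w G).app W) := by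
  haveI := isOpenImmersion_fst_of_isPullback H
  -- the three bijections
  have h₁ : Function.Bijective
      (((Scheme.Modules.restrictFunctorIsoPullback b).hom.app ((Scheme.Modules.pushforward p).obj G)).app W) :=
    ConcreteCategory.bijective_of_isIso _
  have h₂ : Function.Bijective (((Scheme.Modules.restrictFunctorIsoPullback pr).hom.app G).app (pT ⁻¹ᵁ W)) :=
    ConcreteCategory.bijective_of_isIso _
  have h₃ : Function.Bijective (G.presheaf.map (eqToHom (preimage_image_eq_image_preimage H W).symm).op) :=
    ConcreteCategory.bijective_of_isIso _
  have hcomp : ((pushforwardBaseChangeHom H.w G).app W) ∘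
      (((Scheme.Modules.restrictFunctorIsoPullback b).hom.app ((Scheme.Modules.pushforward p).obj G)).app W) =
      (((Scheme.Modules.restrictFunctorIsoPullback pr).hom.app G).app (pT ⁻¹ᵁ W)) ∘
        (fun y : Γ(((Scheme.Modules.pushforward p).obj G).restrict b, W) =>
          (show Γ(G.restrict pr, pT ⁻¹ᵁ W) from
            G.presheaf.map (eqToHom (preimage_image_eq_image_preimage H W).symm).op
              (show Γ(G, p ⁻¹ᵁ b ''ᵁ W) from y))) := by
    funext y
    exact pushforwardBaseChangeHom_app_restrictFunctorIsoPullback H G W y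
  have h' : Function.Bijective (((pushforwardBaseChangeHom H.w G).app W) ∘
      (((Scheme.Modules.restrictFunctorIsoPullback b).hom.app ((Scheme.Modules.pushforward p).obj G)).app W)) := by
    rw [hcomp]
    exact h₂.comp h₃
  exact (Function.Bijective.of_comp_iff _ h₁).mp h'

/-- **Base change of `p_*` along an open immersion of the base is an isomorphism** ([StacksProject, Tag 02KG], trivial
case; [Hartshorne1977] III 9.3.1): for a cartesian square with `b` an open immersion and ANY `𝒪_X`-module `G`,
`pushforwardBaseChangeHom : b^*(p_* G) ⟶ pT_*(pr^* G)` is an isomorphism — «`(p_* G)|_T = (p|_T)_*(G|_{X_T})`».  The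
Zariski-localisation of the (hbc) hypothesis of ★ `Morphisms/ContainmentRepOfPushforward`.
[cite: StacksProject, Tag 02KG] [cite: Hartshorne1977, III Prop. 9.3 (Remark 9.3.1)] -/
theorem isIso_pushforwardBaseChangeHom_of_isOpenImmersion : IsIso (pushforwardBaseChangeHom H.w G) := by
  rw [Scheme.Modules.Hom.isIso_iff_isIso_app]
  intro W
  have hb := pushforwardBaseChangeHom_app_bijective_of_isOpenImmersion H G W
  haveI : IsIso ((forget Ab).map ((pushforwardBaseChangeHom H.w G).app W)) :=
    (isIso_iff_bijective _).mpr hb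
  exact isIso_of_reflects_iso _ (forget Ab)

end OpenImmersion

end Literature.AlgebraicGeometry.Modules

end
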